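import Mathlib
import Summits.ResolutionOfSingularities.ResolutionOfSingularities.Theorems.HomologicalConductorNoZenoBirthDefs
import Summits.ResolutionOfSingularities.ResolutionOfSingularities.Theorems.HomologicalConductorNoZenoTowerNoetherian
import Summits.ResolutionOfSingularities.ResolutionOfSingularities.Theorems.HomologicalConductorPersistenceSurfaceRationalAssembly
import Literature.RingTheory.CohomologyAnnihilator.Basic
import Literature.RingTheory.CohomologyAnnihilator.NonGorensteinLowering
import HarnessLib

/-!
# Rung S-2 `PersistenceSurface` (stmt-ResolutionOfSingularities-19970) — the Sat₄ stub and the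
# NON-GORENSTEIN LOWERING: `I(T)·caⁿ⁺¹(T) ⊆ caⁿ(T)` (`n ≥ 3`) at every stage, `I(T) = ann Ext^{≥3}_T(mod T, T)`

Route `ResolutionOfSingularities/HomologicalConductor`, chain W4.4b, rung S-2 `PersistenceSurface`
(stmt-ResolutionOfSingularities-19970), registered skeleton 1a77c002, stub
`stub_saturationFourSurfaceResidualFour : SaturationFourSurfaceResidual₄` («`ca(T_m) ⊆ ca⁴(T_m)` at the
two-dimensional residual stages»). [OURS · bookkeeping over the LANDED Literature lemma
`Literature.RingTheory.CohomologyAnnihilator.NonGorensteinLowering` (Kimura, arXiv:2409.17934, proof of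
Thm. 2.5); AI-written, weaker than expert review; NOT a statement of the manuscript under study
(Hironaka 2017) and no statement of that manuscript is used.] DEF-FREE: no new `def`, no conjecture.

WHAT IT SAYS FOR THE STUB. Hands 2/6 located the content of Sat₄ at the two-dimensional stages that are NOT
Gorenstein (Gorenstein ⇒ `ca = ca³`, `…SaturationGorenstein`, `…SaturationCompletionGorenstein`). Kimura's
lowering step makes the dependence on the Gorenstein defect QUANTITATIVE and level-wise: for a stage
`T = T_m` (noetherian, `stub_towerNoetherian`) and any `t ∈ T` killing `Extʲ_T(M, T)` for all finitely
generated `M` and all `j ≥ 3` — the ideal `I(T)` of such `t` cuts out the non-Gorenstein locus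
([Kimura2024StabilityCA, Cor. 2.4]); for a Cohen–Macaulay stage it is the stable annihilator
`ann Ext¹(ω_T, Ω ω_T)` of the canonical module, i.e. its trace ideal (Dey) — one has, in the route's inline
`caAt` vocabulary and with EXPONENT ONE per level,

  `t · caAt (n+1) T ⊆ caAt n T` (`n ≥ 3`), `tᵏ · caAt (n+k) T ⊆ caAt n T`, `tᵏ · ca T ⊆ caAt 4 T` for
  `k = s − 4`, `s` the stabilisation index of the stage.

So the stub `ca(T_m) ⊆ ca⁴(T_m)` holds MODULO `I(T_m)`-torsion of exponent `s − 4`, and holds outright where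
`1 ∈ I(T_m)` (`ca_subset_caAt_of_forall_ext_self_eq_zero`: Gorenstein stages, now for ANY noetherian stage,
no domain / injective-dimension instance needed — cf. hand 2's `ca_subset_caAt_four_of_ext_eq_zero`).
HONEST CAVEAT: at a normal surface stage `caAt 3 T` is `𝔪_T`-primary, so the mere EXISTENCE of an exponent
`k` with `tᵏ x ∈ caAt 4 T` is free; the content is the UNIFORM exponent (index minus level) and the
one-step law `I·ca⁴ ⊆ ca³`, which any proof or refutation of Sat₄ at a non-Gorenstein stage must respect
(a witness `x ∈ ca(T) ∖ ca⁴(T)` needs `t·x ∉ ca⁴` to fail for NO `t ∈ I(T)` at the previous level, etc.).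

* `smul_mem_caAt_of_mem_caAt_succ` — `t · caAt (n+1) T ⊆ caAt n T`, `n ≥ 3`, any subalgebra stage `T ⊆ K`
  with `↥T` noetherian;
* `pow_mul_mem_caAt_of_mem_caAt_add` — `tᵏ · caAt (n+k) T ⊆ caAt n T`;
* `exists_pow_mul_mem_caAt_four_of_mem_ca` — `x ∈ ca T ⇒ ∃ k, tᵏ x ∈ caAt 4 T`;
* `ca_subset_caAt_of_forall_ext_self_eq_zero` — `Ext^{≥3}_T(mod T, T) = 0 ⇒ ca T ⊆ caAt n T` (`n ≥ 3`);
* `tower_smul_mem_caAt_of_mem_caAt_succ` — the same at the stage `T_m = tower O A m` of a route datum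
  (noetherianity from `stub_towerNoetherian`).

References: K. Kimura, *Stability of annihilators of cohomology and closed subsets defined by Jacobian
ideals*, arXiv:2409.17934 (2024), proof of Thm. 2.5 [`Kimura2024StabilityCA`] — used only through the landed
Literature lemma; S. B. Iyengar, R. Takahashi, IMRN 2016, Def. 2.1 [`IyengarTakahashi2014`].
-/

noncomputable section

-- single-problem summit: the doubled namespace component `ResolutionOfSingularities` is forced
set_option linter.dupNamespace false

namespace Summit.ResolutionOfSingularities.ResolutionOfSingularities.Theorems.HomologicalConductor.PersistenceSurfaceSaturationNonGorensteinLowering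

open CategoryTheory CategoryTheory.Abelian
open Literature.RingTheory.CohomologyAnnihilator
open Summit.ResolutionOfSingularities.ResolutionOfSingularities.Theorems.NoZeno.Birth
open Summit.ResolutionOfSingularities.ResolutionOfSingularities.Theorems.HomologicalConductor.PersistenceSurfaceRationalAssembly
  (mem_caAt_iff)

variable {k K : Type} [Field k] [Field K] [Algebra k K]

/-! ## Kimura's lowering step at a subalgebra stage -/

/-- **`t · caAt (n+1) T ⊆ caAt n T` for `n ≥ 3`** at a subalgebra stage `T ⊆ K` with `↥T` noetherian, for
every `t ∈ T` killing `Extʲ_T(M, T)` for all finitely generated `M` and all `j ≥ 3` (Kimura's lowering step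
with `d = 2`, `Literature…NonGorensteinLowering.mul_mem_cohomologyAnnihilatorOfDegree_of_forall_smul_ext_self`).
[cite: Kimura2024StabilityCA, Theorem 2.5 (proof)] -/
theorem smul_mem_caAt_of_mem_caAt_succ (T : Subalgebra k K) [IsNoetherianRing ↥T] {t : ↥T}
    (ht : ∀ (M : ModuleCat.{0} ↥T), Module.Finite ↥T M → ∀ j : ℕ, 3 ≤ j →
      ∀ e : CategoryTheory.Abelian.Ext.{0} M (ModuleCat.of ↥T ↥T) j, t • e = 0)
    {n : ℕ} (hn : 3 ≤ n) {x : K}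
    (hx : x ∈ {x : K | ∃ hx : x ∈ T, ∀ i : ℕ, n + 1 ≤ i → ∀ (M N : ModuleCat.{0} ↥T),
      Module.Finite ↥T M → Module.Finite ↥T N →
        ∀ e : CategoryTheory.Abelian.Ext.{0} M N i, (⟨x, hx⟩ : ↥T) • e = 0}) :
    (t : K) * x ∈ {x : K | ∃ hx : x ∈ T, ∀ i : ℕ, n ≤ i → ∀ (M N : ModuleCat.{0} ↥T),
      Module.Finite ↥T M → Module.Finite ↥T N →
        ∀ e : CategoryTheory.Abelian.Ext.{0} M N i, (⟨x, hx⟩ : ↥T) • e = 0} := by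
  rw [mem_caAt_iff] at hx ⊢
  obtain ⟨hxT, hx⟩ := hx
  have hmem : (t : K) * x ∈ T := T.mul_mem t.2 hxT
  refine ⟨hmem, ?_⟩
  have h := mul_mem_cohomologyAnnihilatorOfDegree_of_forall_smul_ext_self (d := 2) (n := n)
    (by omega) ht hx
  have heq : (⟨(t : K) * x, hmem⟩ : ↥T) = t * ⟨x, hxT⟩ := Subtype.ext rfl
  rw [heq]
  exact h

/-- **`tᵏ · caAt (n+k) T ⊆ caAt n T` for `n ≥ 3`** (the iterate). [cite: Kimura2024StabilityCA, Theorem 2.5 (proof)] -/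
theorem pow_mul_mem_caAt_of_mem_caAt_add (T : Subalgebra k K) [IsNoetherianRing ↥T] {t : ↥T}
    (ht : ∀ (M : ModuleCat.{0} ↥T), Module.Finite ↥T M → ∀ j : ℕ, 3 ≤ j →
      ∀ e : CategoryTheory.Abelian.Ext.{0} M (ModuleCat.of ↥T ↥T) j, t • e = 0)
    {n : ℕ} (hn : 3 ≤ n) (k' : ℕ) {x : K}
    (hx : x ∈ {x : K | ∃ hx : x ∈ T, ∀ i : ℕ, n + k' ≤ i → ∀ (M N : ModuleCat.{0} ↥T),
      Module.Finite ↥T M → Module.Finite ↥T N →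
        ∀ e : CategoryTheory.Abelian.Ext.{0} M N i, (⟨x, hx⟩ : ↥T) • e = 0}) :
    (t : K) ^ k' * x ∈ {x : K | ∃ hx : x ∈ T, ∀ i : ℕ, n ≤ i → ∀ (M N : ModuleCat.{0} ↥T),
      Module.Finite ↥T M → Module.Finite ↥T N →
        ∀ e : CategoryTheory.Abelian.Ext.{0} M N i, (⟨x, hx⟩ : ↥T) • e = 0} := by
  rw [mem_caAt_iff] at hx ⊢
  obtain ⟨hxT, hx⟩ := hx
  have hmem : (t : K) ^ k' * x ∈ T := T.mul_mem (T.pow_mem t.2 k') hxT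
  refine ⟨hmem, ?_⟩
  have h := pow_mul_mem_cohomologyAnnihilatorOfDegree_of_forall_smul_ext_self (d := 2) (n := n)
    (by omega) ht k' hx
  have heq : (⟨(t : K) ^ k' * x, hmem⟩ : ↥T) = t ^ k' * ⟨x, hxT⟩ := Subtype.ext (by simp)
  rw [heq]
  exact h

/-- **`x ∈ ca T ⇒ ∃ k, tᵏ x ∈ caAt 4 T`** — every element of the route's `ca T` (`NoZeno.Birth.ca`, verbatim
the route's `let ca`) is lowered to level four by a power of any `t` killing `Ext^{≥3}_T(mod T, T)`; the
exponent is `s − 4` for the stabilisation index `s` of the stage (uniform in `x`). At a normal surface stage the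
bare existence of SOME exponent is free (`caAt 3 T` is `𝔪`-primary); the content is the uniform exponent.
[cite: Kimura2024StabilityCA, Theorem 2.5 (proof)] -/
theorem exists_pow_mul_mem_caAt_four_of_mem_ca (T : Subalgebra k K) [IsNoetherianRing ↥T] {t : ↥T}
    (ht : ∀ (M : ModuleCat.{0} ↥T), Module.Finite ↥T M → ∀ j : ℕ, 3 ≤ j →
      ∀ e : CategoryTheory.Abelian.Ext.{0} M (ModuleCat.of ↥T ↥T) j, t • e = 0)
    {x : K} (hx : x ∈ NoZeno.Birth.ca T) :
    ∃ k' : ℕ, (t : K) ^ k' * x ∈ {x : K | ∃ hx : x ∈ T, ∀ i : ℕ, 4 ≤ i → ∀ (M N : ModuleCat.{0} ↥T),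
      Module.Finite ↥T M → Module.Finite ↥T N →
        ∀ e : CategoryTheory.Abelian.Ext.{0} M N i, (⟨x, hx⟩ : ↥T) • e = 0} := by
  obtain ⟨hxT, N₀, hN₀⟩ := hx
  -- `x ∈ caAt N₀ T ⊆ caAt (4 + N₀) T`
  refine ⟨N₀, pow_mul_mem_caAt_of_mem_caAt_add T ht (n := 4) (by omega) N₀ ⟨hxT, ?_⟩⟩
  intro i hi M N hM hN e
  exact hN₀ i (by omega) M N hM hN e

/-- **Gorenstein stages, any noetherian stage (no domain hypothesis): `Ext^{≥3}_T(mod T, T) = 0 ⇒ ca T ⊆ caAt n T`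
for every `n ≥ 3`** (take `t = 1`; `Literature…cohomologyAnnihilator_eq_of_forall_ext_self_eq_zero`). The `m`-th
conjunct of `SaturationFourSurfaceResidual₄` at such a stage (cf. hand 2's `ca_subset_caAt_four_of_ext_eq_zero`,
which assumed a domain). [cite: Kimura2024StabilityCA, Theorem 2.5] -/
theorem ca_subset_caAt_of_forall_ext_self_eq_zero (T : Subalgebra k K) [IsNoetherianRing ↥T]
    (hGor : ∀ (M : ModuleCat.{0} ↥T), Module.Finite ↥T M → ∀ j : ℕ, 3 ≤ j →
      ∀ e : CategoryTheory.Abelian.Ext.{0} M (ModuleCat.of ↥T ↥T) j, e = 0)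
    {n : ℕ} (hn : 3 ≤ n) :
    NoZeno.Birth.ca T ⊆ {x : K | ∃ hx : x ∈ T, ∀ i : ℕ, n ≤ i → ∀ (M N : ModuleCat.{0} ↥T),
      Module.Finite ↥T M → Module.Finite ↥T N →
        ∀ e : CategoryTheory.Abelian.Ext.{0} M N i, (⟨x, hx⟩ : ↥T) • e = 0} := by
  intro x hx
  obtain ⟨hxT, N₀, hN₀⟩ := hx
  rw [mem_caAt_iff]
  refine ⟨hxT, ?_⟩
  have hxca : (⟨x, hxT⟩ : ↥T) ∈ cohomologyAnnihilator ↥T :=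
    mem_cohomologyAnnihilator_iff.mpr ⟨N₀, mem_cohomologyAnnihilatorOfDegree_iff.mpr hN₀⟩
  rw [cohomologyAnnihilator_eq_of_forall_ext_self_eq_zero (d := 2) hGor] at hxca
  exact cohomologyAnnihilatorOfDegree_mono hn hxca

/-! ## At a stage of a route datum -/

/-- **The lowering step at the stage `T_m = tower O A m` of a route datum** (`p` prime, `CharP k p`, `k ⊆ O`,
`A` finitely generated with `Frac A = K`, `A ⊆ O` — the binders of `PersistenceSurface`; the stage is noetherian by
`stub_towerNoetherian`): for `t ∈ T_m` killing `Ext^{≥3}_{T_m}(mod T_m, T_m)` and `n ≥ 3`,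
`t · caAt (n+1) T_m ⊆ caAt n T_m`. [cite: Kimura2024StabilityCA, Theorem 2.5 (proof)] -/
theorem tower_smul_mem_caAt_of_mem_caAt_succ {p : ℕ} (hp : p.Prime) [CharP k p]
    (O : ValuationSubring K) (A : Subalgebra k K) (hk : ∀ c : k, algebraMap k K c ∈ O) (hA : A.FG)
    (hfr : IsFractionRing ↥A K) (hAO : A.toSubring ≤ O.toSubring) (m : ℕ) {t : ↥(tower O A m)}
    (ht : ∀ (M : ModuleCat.{0} ↥(tower O A m)), Module.Finite ↥(tower O A m) M → ∀ j : ℕ, 3 ≤ j →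
      ∀ e : CategoryTheory.Abelian.Ext.{0} M (ModuleCat.of ↥(tower O A m) ↥(tower O A m)) j,
        t • e = 0)
    {n : ℕ} (hn : 3 ≤ n) {x : K}
    (hx : x ∈ {x : K | ∃ hx : x ∈ tower O A m, ∀ i : ℕ, n + 1 ≤ i →
      ∀ (M N : ModuleCat.{0} ↥(tower O A m)), Module.Finite ↥(tower O A m) M →
        Module.Finite ↥(tower O A m) N →
          ∀ e : CategoryTheory.Abelian.Ext.{0} M N i, (⟨x, hx⟩ : ↥(tower O A m)) • e = 0}) :
    (t : K) * x ∈ {x : K | ∃ hx : x ∈ tower O A m, ∀ i : ℕ, n ≤ i →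
      ∀ (M N : ModuleCat.{0} ↥(tower O A m)), Module.Finite ↥(tower O A m) M →
        Module.Finite ↥(tower O A m) N →
          ∀ e : CategoryTheory.Abelian.Ext.{0} M N i, (⟨x, hx⟩ : ↥(tower O A m)) • e = 0} := by
  have _ := hp
  haveI : IsNoetherianRing ↥(tower O A m) := stub_towerNoetherian k K O A hk hA hfr hAO m
  exact smul_mem_caAt_of_mem_caAt_succ (tower O A m) ht hn hx

end Summit.ResolutionOfSingularities.ResolutionOfSingularities.Theorems.HomologicalConductor.PersistenceSurfaceSaturationNonGorensteinLowering

end
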